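import Literature.Analysis.OperatorTheory.Enflo2023.Lemma1Model
import Literature.Analysis.OperatorTheory.Enflo2023.TypeDichotomy
import HarnessLib

/-!
# Enflo (2023), Lemma 1 as printed: a standing-form, Type-1 operator for which the printed choice of `u₁` fails

Source: P. H. Enflo, *On the invariant subspace problem in Hilbert spaces*, arXiv:2305.15442v2 — a CLAIMED result
under adjudication (b2b-enflo repair cell, formaliser 1).  This file does not endorse the main theorem; it sharpens the
NEGATIVE half of the cell's verdict on one displayed inference (p.7 tex L258–L263 "`u₁` is chosen such that
`‖T*u₁‖ < (εθ)₀`" + pp.8–9 LEMMA 1 "`εθ ≤ ½·10⁻⁵(εθ)₀` for some `0.5 ≥ ε > 0.5 − 10⁻⁵(εθ)₀`").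
BLOCK-2b value: certificate / precise gap, not summit progress.  Companion of `Lemma1.lean` (the REPAIRED Lemma 1,
a theorem: `lemma1_repaired`, choice sharpened to `‖T*u₁‖ ≤ 10⁻⁶(εθ)₀`) and `Lemma1Model.lean` (the rank-one model
`Tmodel = 10⁻²⁰⟨u₀,·⟩u₁`, where the printed choice fails for every `(εθ)₀ ∈ (10⁻²⁰, 1.72·10⁻¹⁵)`).

`Lemma1Model.lean` records the caveat that `Tmodel` is NOT of the manuscript's standing form (it is not injective and
its range is not dense, v2 p.1) and that its `u₀` is not checked to be a Type-1 direction (v2 p.6, (19)).  This file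
removes both caveats with an operator on `ℓ²(ℕ)` inside the standing class:

* `Tst` — `(Tst f)_k = w_k · f_{σ k}`, `σ = (0 1)` the transposition, `w₀ = w₁ = 10⁻²⁰`, `w_k = 10⁻²⁰/(k+1)`
  (`k ≥ 2`): i.e. `10⁻²⁰·(swap of e₀, e₁) ⊕ 10⁻²⁰·diag(1/(k+1))_{k ≥ 2}`.  It is self-adjoint, injective, with dense,
  non-closed range (`Tst_injective`, `Tst_denseRange`, `Tst_not_surjective`), `‖Tst‖ = 10⁻²⁰` EXACTLY (`norm_Tst`,
  the standing normalisation of v2 p.1 / p.12; `ℓ²(ℕ)` is separable and infinite-dimensional: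
  `CaseII.ModelT.separableSpace_ℓ2T`, `CaseII.ModelT.not_finiteDimensional_ℓ2T`), and `Tst` is of TYPE 1 VIA `u₀ = e₀`
  with `δ_n = 10^{-40n}/10⁴`
  (`Tst_type1_via_e0`, `Tst_type1`: `⟨Tst^{2n} f, f⟩ = Σ_k w_k^{2n}|f_k|² ≥ 10^{-40n}|f₀|²`).
* With `u₀ = e₀`, `u₁ = e₁`: `Tst e₀ = 10⁻²⁰e₁`, `Tst* e₁ = Tst e₁ = 10⁻²⁰e₀`, so `‖Tst*u₁‖ = 10⁻²⁰` and the PRINTED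
  requirement `‖T*u₁‖ < (εθ)₀` holds iff `(εθ)₀ > 10⁻²⁰` (`norm_adjoint_Tst_e1`).
* EXACT REDUCTION to the rank-one model (`isMinimal_Pc`): the orbit of `y₀' = (√3/2)e₀` alternates between the `e₀`-
  and `e₁`-axes (`pow_Tst_e0`: `Tst^j e₀ = G_j.1 e₀ + G_j.2 e₁`, `G_{2q} = (10^{-40q}, 0)`, `G_{2q+1} = (0, 10^{-40q-20})`),
  so `V_{y₀'} b = (√3/2)(⟨G.1, b⟩ e₀ + ⟨G.2, b⟩ e₁)` (`V_Tst`); the compression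
  `P b = (⟨G.1,b⟩, 10²⁰⟨G.2,b⟩, 0, 0, …)` satisfies `V^{Tmodel} (P b) = V^{Tst} b`, the dilation `Q a` of a
  `Tmodel`-feasible `a` along `G.1, G.2` satisfies `V^{Tst}(Q a) = V^{Tmodel} a` with `‖Q a‖² = (|a₀|²+|a₁|²)/‖G.1‖²`,
  and Bessel's inequality for the orthogonal pair `G.1 ⟂ G.2` (`‖G.2‖ = 10⁻²⁰‖G.1‖`, `norm_Gv₂_sq`) gives
  `‖P b‖²/‖G.1‖² ≤ ‖b‖²`; hence the compression of the `Tst`-minimiser `ℓ'_ε` IS the `Tmodel`-minimiser, with the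
  same vector `V ℓ'_ε` and the same `εθ`.  Therefore `Lemma1Model.model_etheta_lower_all` transfers verbatim:
  `εθ(ℓ'_ε) ≥ 0.86·10⁻²⁰` for every `ε ∈ [½ − w, ½]`, `0 < w ≤ 2·10⁻⁴` (`etheta_lower_standing`).
* `printed_lemma1_fails_standing_all`, `printed_lemma1_fails_standing`: for EVERY `(εθ)₀ ∈ (10⁻²⁰, 1.72·10⁻¹⁵)` the
  displayed hypotheses of Lemma 1 hold for `(Tst, e₀, e₁)` — standing form, Type 1 via `u₀`, `u₀ ⟂ u₁` unit,
  `‖T*u₁‖ < (εθ)₀` — and its displayed conclusion FAILS at every radius of the printed window.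

Verdict sharpened, not changed: the inference p.7 + pp.8–9 AS PRINTED does not follow EVEN INSIDE the standing class
and the Type-1 branch (the branch in which Lemma 1 is invoked, v2 p.7); it is REPAIRED by `‖T*u₁‖ ≤ 10⁻⁶(εθ)₀`
(`Lemma1.lemma1_repaired`, `Lemma1.exists_unit_orthogonal_adjoint_le`), so Part A is unaffected.  Remaining caveat,
stated not hidden: `u₀ = e₀` is NOT cyclic for `Tst` (`span{e₀, e₁}` reduces `Tst`; every explicit test operator has
invariant subspaces), whereas the manuscript may restrict to cyclic `u₀` ("otherwise we are done", v2 p.3); an exact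
finite reduction as used here is available only for a non-cyclic `u₀`, and cyclicity is not a quantitative hypothesis
that the printed proof of Lemma 1 invokes.
Origin: planner-b2b-enflo-1-g10-0 (formaliser 1, gen 10), 2026-08-19.
-/

noncomputable section

open scoped InnerProductSpace ENNReal
open ContinuousLinearMap

namespace Literature.Analysis.OperatorTheory.Enflo2023

namespace Lemma1

namespace Standing

open Vy
open Literature.Analysis.UnboundedOperators (inner_self_eq_coe_norm_sq)

/-! ### Coordinates: the transposition `σ = (0 1)` and the weights -/

/-- The coordinate permutation `σ = (0 1)` of `ℕ`. [folklore] -/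
def sw : Equiv.Perm ℕ := Equiv.swap 0 1

/-- `σ 0 = 1`. [folklore] -/
@[simp] lemma sw_zero : sw 0 = 1 := by simp [sw]

/-- `σ 1 = 0`. [folklore] -/
@[simp] lemma sw_one : sw 1 = 0 := by simp [sw]

/-- `σ k = k` for `k ≥ 2`. [folklore] -/
lemma sw_of_two_le {k : ℕ} (hk : 2 ≤ k) : sw k = k := by
  unfold sw
  exact Equiv.swap_apply_of_ne_of_ne (by omega) (by omega)

/-- `σ` is an involution. [folklore] -/
@[simp] lemma sw_sw (k : ℕ) : sw (sw k) = k := by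
  unfold sw
  exact Equiv.swap_apply_self _ _ _

/-- `σ` preserves `{0, 1}`. [folklore] -/
lemma sw_lt_two_iff (k : ℕ) : sw k < 2 ↔ k < 2 := by
  rcases Nat.lt_or_ge k 2 with h | h
  · interval_cases k <;> simp
  · rw [sw_of_two_le h]

/-- The weights: `w₀ = w₁ = 10⁻²⁰`, `w_k = 10⁻²⁰/(k+1)` for `k ≥ 2`. [cite: Enflo2023, v2 p.1 (‖T‖ = 10⁻²⁰), test operator] -/
def wS (k : ℕ) : ℝ := if k < 2 then 1 / 10 ^ 20 else 1 / 10 ^ 20 / (k + 1)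

/-- The weights are positive. [folklore] -/
lemma wS_pos (k : ℕ) : 0 < wS k := by
  unfold wS; split_ifs <;> positivity

/-- The weights are `≤ 10⁻²⁰`. [folklore] -/
lemma wS_le (k : ℕ) : wS k ≤ 1 / 10 ^ 20 := by
  unfold wS; split_ifs with h
  · exact le_rfl
  · rw [div_le_iff₀ (by positivity)]
    have : (1 : ℝ) ≤ (k : ℝ) + 1 := by have := Nat.cast_nonneg (α := ℝ) k; linarith
    nlinarith

/-- `w₀ = 10⁻²⁰`. [folklore] -/
@[simp] lemma wS_zero : wS 0 = 1 / 10 ^ 20 := by unfold wS; simp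

/-- `w₁ = 10⁻²⁰`. [folklore] -/
@[simp] lemma wS_one : wS 1 = 1 / 10 ^ 20 := by unfold wS; simp

/-- The weights are `σ`-invariant. [folklore] -/
lemma wS_sw (k : ℕ) : wS (sw k) = wS k := by
  rcases Nat.lt_or_ge k 2 with h | h
  · interval_cases k <;> simp
  · rw [sw_of_two_le h]

/-- A bound good for square-summability: `w_k ≤ 2·10⁻²⁰/(k+1)`. [folklore] -/
lemma wS_le_div (k : ℕ) : wS k ≤ 2 / 10 ^ 20 / ((k : ℝ) + 1) := by
  have hk0 : (0 : ℝ) ≤ k := Nat.cast_nonneg k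
  unfold wS; split_ifs with h
  · have hk : (k : ℝ) ≤ 1 := by exact_mod_cast Nat.lt_succ_iff.mp h
    rw [le_div_iff₀ (by positivity)]
    nlinarith
  · rw [div_le_div_iff_of_pos_right (by positivity)]
    norm_num

/-! ### The operator `Tst` on `ℓ²(ℕ)` -/

/-- Pointwise: the image sequence `k ↦ w_k f_{σ k}` is square-summable. [folklore] -/
lemma memℓp_T (f : ℓ2) : Memℓp (fun k => (wS k : ℂ) * f (sw k)) 2 := by
  rw [memℓp_gen_iff (by norm_num : 0 < (2 : ℝ≥0∞).toReal)]
  simp only [ENNReal.toReal_ofNat, Real.rpow_two]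
  have hs : Summable (fun k => ‖f (sw k)‖ ^ 2) :=
    (Equiv.summable_iff sw (f := fun k => ‖f k‖ ^ 2)).2 (summable_sq f)
  refine Summable.of_nonneg_of_le (fun k => by positivity) (fun k => ?_) (hs.mul_left ((1 / 10 ^ 20) ^ 2))
  rw [norm_mul, mul_pow, Complex.norm_real, Real.norm_eq_abs, abs_of_pos (wS_pos k)]
  exact mul_le_mul_of_nonneg_right (pow_le_pow_left₀ (wS_pos k).le (wS_le k) 2) (by positivity)

/-- The operator as a linear map. [folklore] -/
def Tlin : ℓ2 →ₗ[ℂ] ℓ2 where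
  toFun f := ⟨fun k => (wS k : ℂ) * f (sw k), memℓp_T f⟩
  map_add' f g := by
    apply lp.ext
    funext k
    simp [mul_add]
  map_smul' c f := by
    apply lp.ext
    funext k
    simp [lp.coeFn_smul, mul_left_comm]

/-- Coordinates of the linear map. [folklore] -/
lemma Tlin_apply (f : ℓ2) (k : ℕ) : (Tlin f) k = (wS k : ℂ) * f (sw k) := rfl

/-- Norm bound `‖T f‖ ≤ 10⁻²⁰‖f‖` (reindex the sum by `σ`). [folklore] -/
lemma norm_Tlin_le (f : ℓ2) : ‖Tlin f‖ ≤ 1 / 10 ^ 20 * ‖f‖ := by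
  have h1 := norm_sq_eq_tsum (Tlin f)
  have h2 := norm_sq_eq_tsum f
  have hs : Summable (fun k => ‖f (sw k)‖ ^ 2) :=
    (Equiv.summable_iff sw (f := fun k => ‖f k‖ ^ 2)).2 (summable_sq f)
  have hre : ∑' k, ‖f (sw k)‖ ^ 2 = ∑' k, ‖f k‖ ^ 2 := Equiv.tsum_eq sw (fun k => ‖f k‖ ^ 2)
  have hle : ∑' k, ‖(Tlin f) k‖ ^ 2 ≤ ∑' k, (1 / 10 ^ 20 : ℝ) ^ 2 * ‖f (sw k)‖ ^ 2 := by
    refine Summable.tsum_le_tsum (fun k => ?_) (summable_sq (Tlin f)) (hs.mul_left _)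
    rw [Tlin_apply, norm_mul, mul_pow, Complex.norm_real, Real.norm_eq_abs, abs_of_pos (wS_pos k)]
    exact mul_le_mul_of_nonneg_right (pow_le_pow_left₀ (wS_pos k).le (wS_le k) 2) (by positivity)
  rw [tsum_mul_left, hre] at hle
  have h3 : ‖Tlin f‖ ^ 2 ≤ (1 / 10 ^ 20 * ‖f‖) ^ 2 := by
    calc ‖Tlin f‖ ^ 2 = ∑' k, ‖(Tlin f) k‖ ^ 2 := h1
      _ ≤ (1 / 10 ^ 20 : ℝ) ^ 2 * ∑' k, ‖f k‖ ^ 2 := hle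
      _ = (1 / 10 ^ 20 * ‖f‖) ^ 2 := by rw [mul_pow, h2]
  exact (pow_le_pow_iff_left₀ (norm_nonneg _) (by positivity) two_ne_zero).1 h3

/-- **The test operator `Tst`**: `10⁻²⁰·(swap of e₀,e₁) ⊕ 10⁻²⁰·diag(1/(k+1))_{k≥2}` on `ℓ²(ℕ)`.
[cite: Enflo2023, v2 p.1 (standing form), test operator] -/
def Tst : ℓ2 →L[ℂ] ℓ2 := Tlin.mkContinuous (1 / 10 ^ 20) norm_Tlin_le

/-- Coordinates of `Tst`: `(Tst f)_k = w_k f_{σ k}`. [folklore] -/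
@[simp] lemma Tst_apply (f : ℓ2) (k : ℕ) : (Tst f) k = (wS k : ℂ) * f (sw k) := rfl

/-- The standard unit vectors `e_k` of `ℓ²(ℕ)`. [folklore] -/
def e (k : ℕ) : ℓ2 := lp.single 2 k (1 : ℂ)

/-- Coordinates of `e_k`. [folklore] -/
lemma e_apply (k j : ℕ) : e k j = if j = k then 1 else 0 := by
  classical
  unfold e; rw [lp.single_apply, Pi.single_apply]

/-- `‖e_k‖ = 1`. [folklore] -/
@[simp] lemma norm_e (k : ℕ) : ‖e k‖ = 1 := by
  unfold e; rw [lp.norm_single (by norm_num)]; simp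

/-- `⟨e_k, f⟩ = f_k`. [folklore] -/
lemma inner_e_left (k : ℕ) (f : ℓ2) : ⟪e k, f⟫_ℂ = f k := by
  classical
  unfold e; rw [lp.inner_single_left, RCLike.inner_apply', map_one, one_mul]

/-- `e₀ ⟂ e₁`. [folklore] -/
lemma inner_e0_e1 : ⟪e 0, e 1⟫_ℂ = 0 := by
  rw [inner_e_left, e_apply]; simp

/-- `Tst e₀ = 10⁻²⁰ e₁`. [cite: Enflo2023, v2 p.7, test operator] -/
lemma Tst_e0 : Tst (e 0) = ((1 / 10 ^ 20 : ℝ) : ℂ) • e 1 := by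
  apply lp.ext
  funext k
  rw [lp.coeFn_smul, Pi.smul_apply, Tst_apply, smul_eq_mul, e_apply, e_apply]
  by_cases hk : k = 1
  · subst hk; simp
  · have : sw k ≠ 0 := fun h => hk (by simpa using congrArg sw h)
    simp [hk, this]

/-- `Tst e₁ = 10⁻²⁰ e₀`. [cite: Enflo2023, v2 p.7, test operator] -/
lemma Tst_e1 : Tst (e 1) = ((1 / 10 ^ 20 : ℝ) : ℂ) • e 0 := by
  apply lp.ext
  funext k
  rw [lp.coeFn_smul, Pi.smul_apply, Tst_apply, smul_eq_mul, e_apply, e_apply]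
  by_cases hk : k = 0
  · subst hk; simp
  · have : sw k ≠ 1 := fun h => hk (by simpa using congrArg sw h)
    simp [hk, this]

/-- `‖Tst‖ = 10⁻²⁰` exactly (the manuscript's normalisation). [cite: Enflo2023, v2 p.1, p.12 (K = 10²⁰)] -/
lemma norm_Tst : ‖Tst‖ = 1 / 10 ^ 20 := by
  refine le_antisymm (LinearMap.mkContinuous_norm_le _ (by norm_num) _) ?_
  have h1 := Tst.le_opNorm (e 0)
  rw [Tst_e0, norm_smul, norm_e, norm_e, Complex.norm_real, Real.norm_eq_abs,
    abs_of_pos (by norm_num), mul_one, mul_one] at h1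
  exact h1

/-- `‖Tst‖ < 1` (so `V_y` of (2) is defined). [folklore] -/
lemma norm_Tst_lt_one : ‖Tst‖ < 1 := by rw [norm_Tst]; norm_num

/-- `Tst` is injective (all weights non-zero, `σ` a bijection). [cite: Enflo2023, v2 p.1 ("one-to-one")] -/
lemma Tst_injective : Function.Injective Tst := by
  refine (injective_iff_map_eq_zero Tst).2 (fun f hf => ?_)
  apply lp.ext
  funext k
  have hk := congrArg (fun g : ℓ2 => g (sw k)) hf
  simp only [Tst_apply, sw_sw, lp.coeFn_zero, Pi.zero_apply, mul_eq_zero, Complex.ofReal_eq_zero] at hk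
  rcases hk with hk | hk
  · exact absurd hk (wS_pos _).ne'
  · simpa using hk

/-- `Tst` is self-adjoint (real `σ`-invariant weights, `σ` an involution). [folklore] -/
lemma Tst_isSelfAdjoint : IsSelfAdjoint Tst := by
  rw [ContinuousLinearMap.isSelfAdjoint_iff_isSymmetric]
  intro f g
  change ⟪Tst f, g⟫_ℂ = ⟪f, Tst g⟫_ℂ
  rw [lp.inner_eq_tsum, lp.inner_eq_tsum, ← Equiv.tsum_eq sw (fun k => ⟪f k, (Tst g) k⟫_ℂ)]
  congr 1
  funext k
  rw [Tst_apply, Tst_apply, sw_sw, wS_sw, RCLike.inner_apply', RCLike.inner_apply', map_mul,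
    Complex.conj_ofReal]
  ring

/-- `Tst` is NOT surjective: `(w_k)_k ∈ ℓ²` has the non-`ℓ²` preimage `(1,1,1,…)` — the range is dense but not
closed. [cite: Enflo2023, v2 p.1 ("the range of T is not closed")] -/
lemma Tst_not_surjective : ¬ Function.Surjective Tst := by
  -- the weight sequence itself is in `ℓ²`
  have hmem : Memℓp (fun k => (wS k : ℂ)) 2 := by
    rw [memℓp_gen_iff (by norm_num : 0 < (2 : ℝ≥0∞).toReal)]
    simp only [ENNReal.toReal_ofNat, Real.rpow_two, Complex.norm_real, Real.norm_eq_abs, sq_abs]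
    have hs : Summable (fun n : ℕ => 1 / ((n : ℝ) + 1) ^ 2) := by
      have := (summable_nat_add_iff 1).mpr (Real.summable_one_div_nat_pow.mpr one_lt_two)
      simpa [Nat.cast_add, Nat.cast_one] using this
    refine Summable.of_nonneg_of_le (fun k => sq_nonneg _) (fun k => ?_) (hs.mul_left ((2 / 10 ^ 20) ^ 2))
    have h1 := wS_le_div k
    have h2 := (wS_pos k).le
    have hk : (0 : ℝ) < (k : ℝ) + 1 := by positivity
    calc wS k ^ 2 ≤ (2 / 10 ^ 20 / ((k : ℝ) + 1)) ^ 2 := pow_le_pow_left₀ h2 h1 2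
      _ = (2 / 10 ^ 20) ^ 2 * (1 / ((k : ℝ) + 1) ^ 2) := by field_simp
  intro hs
  obtain ⟨f, hf⟩ := hs ⟨fun k => (wS k : ℂ), hmem⟩
  have hk : ∀ k, f k = 1 := by
    intro k
    have h := congrArg (fun g : ℓ2 => g (sw k)) hf
    simp only [Tst_apply, sw_sw] at h
    have hd : (wS (sw k) : ℂ) ≠ 0 := Complex.ofReal_ne_zero.mpr (wS_pos _).ne'
    have h' : (wS (sw k) : ℂ) * f k = (wS (sw k) : ℂ) * 1 := by rw [mul_one]; exact h
    exact mul_left_cancel₀ hd h'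
  have ht := (summable_sq f).tendsto_atTop_zero
  simp only [hk, norm_one, one_pow] at ht
  have := tendsto_nhds_unique ht tendsto_const_nhds
  exact zero_ne_one this

/-- `Tst` has dense range (self-adjoint and injective). [cite: Enflo2023, v2 p.1 ("dense range")] -/
lemma Tst_denseRange : DenseRange Tst := by
  have hker : LinearMap.ker (Tst : ℓ2 →ₗ[ℂ] ℓ2) = ⊥ :=
    LinearMap.ker_eq_bot.mpr (by exact Tst_injective)
  have h1 := Tst.orthogonal_ker
  rw [hker, Submodule.bot_orthogonal_eq_top, ContinuousLinearMap.isSelfAdjoint_iff'.1 Tst_isSelfAdjoint] at h1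
  have h2 : Dense ((LinearMap.range (Tst : ℓ2 →ₗ[ℂ] ℓ2) : Submodule ℂ ℓ2) : Set ℓ2) :=
    Submodule.dense_iff_topologicalClosure_eq_top.mpr h1.symm
  have h3 : ((LinearMap.range (Tst : ℓ2 →ₗ[ℂ] ℓ2) : Submodule ℂ ℓ2) : Set ℓ2) = Set.range Tst := by
    ext x
    simp only [SetLike.mem_coe, LinearMap.mem_range, Set.mem_range, ContinuousLinearMap.coe_coe]
  rw [h3] at h2
  exact h2

/-- `Tst* e₁ = 10⁻²⁰ e₀`. [cite: Enflo2023, v2 p.7 (choice of u₁), test operator] -/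
lemma adjoint_Tst_e1 : adjoint Tst (e 1) = ((1 / 10 ^ 20 : ℝ) : ℂ) • e 0 := by
  rw [ContinuousLinearMap.isSelfAdjoint_iff'.1 Tst_isSelfAdjoint, Tst_e1]

/-- `‖Tst* u₁‖ = 10⁻²⁰` for `u₁ = e₁`: the printed requirement `‖T*u₁‖ < (εθ)₀` holds iff `(εθ)₀ > 10⁻²⁰`.
[cite: Enflo2023, v2 p.7, choice of u₁] -/
lemma norm_adjoint_Tst_e1 : ‖adjoint Tst (e 1)‖ = 1 / 10 ^ 20 := by
  rw [adjoint_Tst_e1, norm_smul, norm_e, Complex.norm_real, Real.norm_eq_abs, abs_of_pos (by norm_num),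
    mul_one]

/-! ### `Tst` is of Type 1 via `u₀ = e₀` -/

/-- `Tst²` is diagonal: `(Tst (Tst f))_k = w_k² f_k`. [folklore] -/
lemma Tst_Tst_apply (f : ℓ2) (k : ℕ) : (Tst (Tst f)) k = ((wS k ^ 2 : ℝ) : ℂ) * f k := by
  rw [Tst_apply, Tst_apply, sw_sw, wS_sw]
  push_cast
  ring

/-- Hence `(Tst^{2n} f)_k = w_k^{2n} f_k`. [folklore] -/
lemma Tst_iterate_two_mul_apply (n : ℕ) (f : ℓ2) (k : ℕ) :
    ((⇑Tst)^[2 * n] f) k = (((wS k ^ 2) ^ n : ℝ) : ℂ) * f k := by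
  rw [Function.iterate_mul]
  induction n with
  | zero => simp
  | succ n ih =>
      rw [Function.iterate_succ_apply']
      have h2 : ∀ g : ℓ2, ((⇑Tst)^[2] g) k = ((wS k ^ 2 : ℝ) : ℂ) * g k := fun g => by
        rw [Function.iterate_succ_apply', Function.iterate_one, Tst_Tst_apply]
      rw [h2, ih]
      push_cast
      ring

/-- The terms `w_k^{2n} |f_k|²` are summable. [folklore] -/
lemma summable_wS_pow_mul_sq (n : ℕ) (f : ℓ2) : Summable (fun k => (wS k ^ 2) ^ n * ‖f k‖ ^ 2) := by
  refine Summable.of_nonneg_of_le (fun k => by have := wS_pos k; positivity) (fun k => ?_) (summable_sq f)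
  have h0 : wS k ^ 2 ≤ 1 := by
    have h1 := wS_le k
    have h2 := (wS_pos k).le
    nlinarith
  have h1 : (wS k ^ 2) ^ n ≤ 1 := pow_le_one₀ (by positivity) h0
  have h2 : 0 ≤ ‖f k‖ ^ 2 := by positivity
  nlinarith

/-- `⟨Tst^{2n} f, f⟩ = Σ_k w_k^{2n} |f_k|²` (real, non-negative). [folklore] -/
lemma inner_Tst_iterate (n : ℕ) (f : ℓ2) :
    ⟪(⇑Tst)^[2 * n] f, f⟫_ℂ = ((∑' k, (wS k ^ 2) ^ n * ‖f k‖ ^ 2 : ℝ) : ℂ) := by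
  rw [lp.inner_eq_tsum, Complex.ofReal_tsum]
  congr 1
  funext k
  rw [Tst_iterate_two_mul_apply, RCLike.inner_apply', map_mul, Complex.conj_ofReal, mul_assoc,
    Complex.conj_mul']
  push_cast
  ring

/-- **`Tst` is of Type 1 via `u₀ = e₀`** ((19) of v2 p.6), with `j = 2n` and `δ_n = 10^{-40n}/10⁴`: for `f` in the
cone `Re f₀ ≥ ‖f‖/100`, `⟨Tst^{2n} f, f⟩ ≥ w₀^{2n}|f₀|² ≥ 10^{-40n}‖f‖²/10⁴`. [cite: Enflo2023, v2 p.6] -/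
theorem Tst_type1_via_e0 (n : ℕ) (_hn : 1 ≤ n) : ∃ δ : ℝ, 0 < δ ∧ ∀ f : ℓ2, Referee.AngleCond (e 0) f →
    ∃ j : ℕ, n ≤ j ∧ δ * ‖f‖ ^ 2 ≤ ‖⟪(⇑Tst)^[j] f, f⟫_ℂ‖ := by
  refine ⟨((1 / 10 ^ 20) ^ 2) ^ n / 10 ^ 4, by positivity, fun f hf => ⟨2 * n, by omega, ?_⟩⟩
  obtain ⟨-, hang⟩ := hf
  have h1 : (⟪e 0, f⟫_ℂ).re = (f 0).re := by rw [inner_e_left]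
  rw [h1] at hang
  have hs := summable_wS_pow_mul_sq n f
  have h2 : (wS 0 ^ 2) ^ n * ‖f 0‖ ^ 2 ≤ ∑' k, (wS k ^ 2) ^ n * ‖f k‖ ^ 2 :=
    hs.le_tsum 0 (fun k _ => by have := wS_pos k; positivity)
  rw [wS_zero] at h2
  rw [inner_Tst_iterate, Complex.norm_real, Real.norm_of_nonneg
    (tsum_nonneg (fun k => by have := wS_pos k; positivity))]
  have h3 : |(f 0).re| ≤ ‖f 0‖ := Complex.abs_re_le_norm _
  have h4 : (1 / 100 : ℝ) * ‖f‖ ≤ ‖f 0‖ := hang.trans ((le_abs_self _).trans h3)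
  have h5 : ((1 / 100 : ℝ) * ‖f‖) ^ 2 ≤ ‖f 0‖ ^ 2 := pow_le_pow_left₀ (by positivity) h4 2
  have h6 : (0 : ℝ) ≤ ((1 / 10 ^ 20) ^ 2) ^ n := by positivity
  calc ((1 / 10 ^ 20 : ℝ) ^ 2) ^ n / 10 ^ 4 * ‖f‖ ^ 2
      = ((1 / 10 ^ 20) ^ 2) ^ n * ((1 / 100 : ℝ) * ‖f‖) ^ 2 := by ring
    _ ≤ ((1 / 10 ^ 20) ^ 2) ^ n * ‖f 0‖ ^ 2 := mul_le_mul_of_nonneg_left h5 h6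
    _ ≤ ∑' k, (wS k ^ 2) ^ n * ‖f k‖ ^ 2 := h2

/-- `Tst` is of Type 1 (v2 p.6), the direction being the `u₀ = e₀` of the construction below. [cite: Enflo2023, v2 p.6] -/
theorem Tst_type1 : Referee.Type1 Tst :=
  ⟨e 0, norm_e 0, Tst_type1_via_e0⟩

/-! ### The orbit of `y₀' = (√3/2)e₀` and the operator `V_{y₀'}` -/

/-- The orbit coefficients: `Tst^j e₀ = G_j.1 e₀ + G_j.2 e₁`, `G₀ = (1,0)`, `G_{j+1} = 10⁻²⁰(G_j.2, G_j.1)`.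
[cite: Enflo2023, v2 p.2 eq. (2), test operator] -/
def G : ℕ → ℝ × ℝ
  | 0 => (1, 0)
  | j + 1 => (1 / 10 ^ 20 * (G j).2, 1 / 10 ^ 20 * (G j).1)

/-- `G₀ = (1, 0)`. [folklore] -/
@[simp] lemma G_zero : G 0 = (1, 0) := rfl

/-- The recursion. [folklore] -/
lemma G_succ (j : ℕ) : G (j + 1) = (1 / 10 ^ 20 * (G j).2, 1 / 10 ^ 20 * (G j).1) := rfl

/-- Both coefficients are non-negative. [folklore] -/
lemma G_nonneg (j : ℕ) : 0 ≤ (G j).1 ∧ 0 ≤ (G j).2 := by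
  induction j with
  | zero => simp
  | succ j ih => rw [G_succ]; exact ⟨by nlinarith [ih.2], by nlinarith [ih.1]⟩

/-- Both coefficients are `≤ 10^{-20j}`. [folklore] -/
lemma G_le (j : ℕ) : (G j).1 ≤ (1 / 10 ^ 20) ^ j ∧ (G j).2 ≤ (1 / 10 ^ 20) ^ j := by
  induction j with
  | zero => simp
  | succ j ih =>
      rw [G_succ, pow_succ]
      constructor
      · show 1 / 10 ^ 20 * (G j).2 ≤ (1 / 10 ^ 20) ^ j * (1 / 10 ^ 20)
        nlinarith [ih.2]
      · show 1 / 10 ^ 20 * (G j).1 ≤ (1 / 10 ^ 20) ^ j * (1 / 10 ^ 20)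
        nlinarith [ih.1]

/-- At every time one of the two coefficients vanishes (the orbit alternates between the two axes). [folklore] -/
lemma G_mul (j : ℕ) : (G j).1 * (G j).2 = 0 := by
  induction j with
  | zero => simp
  | succ j ih =>
      rw [G_succ]
      show 1 / 10 ^ 20 * (G j).2 * (1 / 10 ^ 20 * (G j).1) = 0
      nlinarith [ih]

/-- **The orbit**: `Tst^j e₀ = G_j.1 e₀ + G_j.2 e₁`. [cite: Enflo2023, v2 p.2 eq. (2), test operator] -/
lemma pow_Tst_e0 (j : ℕ) : (Tst ^ j) (e 0) = ((G j).1 : ℂ) • e 0 + ((G j).2 : ℂ) • e 1 := by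
  induction j with
  | zero => simp
  | succ j ih =>
      rw [pow_succ', mul_apply_eq_comp, ih, map_add, map_smul, map_smul, Tst_e0, Tst_e1, G_succ]
      push_cast
      module

/-- A non-negative real sequence dominated by `10^{-20j}` is square-summable (as a complex sequence). [folklore] -/
lemma memℓp_of_le_geom (g : ℕ → ℝ) (h0 : ∀ j, 0 ≤ g j) (hle : ∀ j, g j ≤ (1 / 10 ^ 20) ^ j) :
    Memℓp (fun j => ((g j : ℝ) : ℂ)) 2 := by
  rw [memℓp_gen_iff (by norm_num : 0 < (2 : ℝ≥0∞).toReal)]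
  simp only [ENNReal.toReal_ofNat, Real.rpow_two, Complex.norm_real, Real.norm_eq_abs, sq_abs]
  have hg : Summable (fun j : ℕ => (((1 / 10 ^ 20 : ℝ) ^ 2) ^ j)) :=
    summable_geometric_of_lt_one (by positivity) (by norm_num)
  refine Summable.of_nonneg_of_le (fun j => sq_nonneg _) (fun j => ?_) hg
  rw [← pow_mul, mul_comm, pow_mul]
  exact pow_le_pow_left₀ (h0 j) (hle j) 2

/-- The `e₀`-coefficient functional of the orbit, as a vector of `ℓ²`: `(G_j.1)_j = (1, 0, 10⁻⁴⁰, 0, 10⁻⁸⁰, …)`. [folklore] -/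
def Gv₁ : ℓ2 :=
  ⟨fun j => ((G j).1 : ℂ), memℓp_of_le_geom (fun j => (G j).1) (fun j => (G_nonneg j).1) (fun j => (G_le j).1)⟩

/-- The `e₁`-coefficient functional of the orbit, as a vector of `ℓ²`: `(G_j.2)_j = (0, 10⁻²⁰, 0, 10⁻⁶⁰, …)`. [folklore] -/
def Gv₂ : ℓ2 :=
  ⟨fun j => ((G j).2 : ℂ), memℓp_of_le_geom (fun j => (G j).2) (fun j => (G_nonneg j).2) (fun j => (G_le j).2)⟩

/-- Coordinates of `Gv₁`. [folklore] -/
@[simp] lemma Gv₁_apply (j : ℕ) : Gv₁ j = ((G j).1 : ℂ) := rfl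

/-- Coordinates of `Gv₂`. [folklore] -/
@[simp] lemma Gv₂_apply (j : ℕ) : Gv₂ j = ((G j).2 : ℂ) := rfl

/-- **`V_{y₀'}` for `Tst`**: `V_{y₀'} a = (√3/2)(⟨Gv₁, a⟩ e₀ + ⟨Gv₂, a⟩ e₁)`. [cite: Enflo2023, v2 p.2 eq. (2), test operator] -/
theorem V_Tst (hT : ‖Tst‖ < 1) (a : ℓ2) : V Tst hT (yStart (e 0)) a =
    (((Real.sqrt 3 / 2 : ℝ) : ℂ) * ⟪Gv₁, a⟫_ℂ) • e 0 + (((Real.sqrt 3 / 2 : ℝ) : ℂ) * ⟪Gv₂, a⟫_ℂ) • e 1 := by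
  set c : ℂ := ((Real.sqrt 3 / 2 : ℝ) : ℂ) with hc
  have hterm : ∀ j, a j • (Tst ^ j) (yStart (e 0)) =
      (a j * c * ((G j).1 : ℂ)) • e 0 + (a j * c * ((G j).2 : ℂ)) • e 1 := by
    intro j
    rw [yStart, map_smul, pow_Tst_e0, ← hc]
    module
  -- summability of the two scalar series (|a_j| 10^{-20j} is summable)
  have hco := summable_coeff Tst hT a
  rw [norm_Tst] at hco
  have hc1 : ‖c‖ ≤ 1 := by
    rw [hc, Complex.norm_real, Real.norm_of_nonneg (by positivity)]
    have h3 : Real.sqrt 3 ≤ 2 := by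
      rw [show (2 : ℝ) = Real.sqrt 4 by rw [show (4 : ℝ) = 2 ^ 2 by norm_num, Real.sqrt_sq (by norm_num)]]
      exact Real.sqrt_le_sqrt (by norm_num)
    linarith
  have hs1 : Summable (fun j => a j * c * ((G j).1 : ℂ)) := by
    refine Summable.of_norm_bounded hco (fun j => ?_)
    rw [norm_mul, norm_mul, Complex.norm_of_nonneg (G_nonneg j).1]
    calc ‖a j‖ * ‖c‖ * (G j).1 ≤ ‖a j‖ * 1 * (1 / 10 ^ 20) ^ j := by
          gcongr
          · exact (G_nonneg j).1
          · exact (G_le j).1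
      _ = ‖a j‖ * (1 / 10 ^ 20) ^ j := by ring
  have hs2 : Summable (fun j => a j * c * ((G j).2 : ℂ)) := by
    refine Summable.of_norm_bounded hco (fun j => ?_)
    rw [norm_mul, norm_mul, Complex.norm_of_nonneg (G_nonneg j).2]
    calc ‖a j‖ * ‖c‖ * (G j).2 ≤ ‖a j‖ * 1 * (1 / 10 ^ 20) ^ j := by
          gcongr
          · exact (G_nonneg j).2
          · exact (G_le j).2
      _ = ‖a j‖ * (1 / 10 ^ 20) ^ j := by ring
  have h1 : ∑' j, a j * c * ((G j).1 : ℂ) = c * ⟪Gv₁, a⟫_ℂ := by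
    rw [lp.inner_eq_tsum, ← tsum_mul_left]
    congr 1
    funext j
    rw [Gv₁_apply, RCLike.inner_apply', Complex.conj_ofReal]
    ring
  have h2 : ∑' j, a j * c * ((G j).2 : ℂ) = c * ⟪Gv₂, a⟫_ℂ := by
    rw [lp.inner_eq_tsum, ← tsum_mul_left]
    congr 1
    funext j
    rw [Gv₂_apply, RCLike.inner_apply', Complex.conj_ofReal]
    ring
  rw [V_apply, show (fun j => a j • (Tst ^ j) (yStart (e 0))) =
      fun j => (a j * c * ((G j).1 : ℂ)) • e 0 + (a j * c * ((G j).2 : ℂ)) • e 1 from funext hterm,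
    (hs1.smul_const (e 0)).tsum_add (hs2.smul_const (e 1)), hs1.tsum_smul_const, hs2.tsum_smul_const, h1, h2]

/-! ### The exact reduction to the rank-one model `Tmodel e₀ e₁` -/

/-- `‖Gv₂‖² = 10⁻⁴⁰‖Gv₁‖²` (shift the recursion `G_{j+1}.2 = 10⁻²⁰ G_j.1` through the sum). [folklore] -/
lemma norm_Gv₂_sq : ‖Gv₂‖ ^ 2 = (1 / 10 ^ 20) ^ 2 * ‖Gv₁‖ ^ 2 := by
  rw [norm_sq_eq_tsum Gv₂, norm_sq_eq_tsum Gv₁, (summable_sq Gv₂).tsum_eq_zero_add, ← tsum_mul_left]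
  have h0 : ‖Gv₂ 0‖ ^ 2 = 0 := by simp
  rw [h0, zero_add]
  congr 1
  funext j
  rw [Gv₂_apply, Gv₁_apply, G_succ, Complex.norm_real, Complex.norm_real, Real.norm_eq_abs, Real.norm_eq_abs,
    sq_abs, sq_abs]
  ring

/-- `‖Gv₁‖ ≥ 1` (its `0`-th coordinate is `1`). [folklore] -/
lemma one_le_norm_Gv₁ : 1 ≤ ‖Gv₁‖ := by
  have h := lp.norm_apply_le_norm (by norm_num : (2 : ℝ≥0∞) ≠ 0) Gv₁ 0
  simpa using h

/-- `Gv₁ ⟂ Gv₂` (disjoint supports). [folklore] -/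
lemma inner_Gv₁_Gv₂ : ⟪Gv₁, Gv₂⟫_ℂ = 0 := by
  rw [lp.inner_eq_tsum]
  have : (fun j => ⟪Gv₁ j, Gv₂ j⟫_ℂ) = fun _ => 0 := by
    funext j
    rw [Gv₁_apply, Gv₂_apply, RCLike.inner_apply', Complex.conj_ofReal, ← Complex.ofReal_mul, G_mul,
      Complex.ofReal_zero]
  rw [this, tsum_zero]

/-- Bessel's inequality for an orthogonal pair of non-zero vectors of `ℓ²`. [folklore] -/
lemma bessel_pair {u w : ℓ2} (hu : u ≠ 0) (hw : w ≠ 0) (huw : ⟪u, w⟫_ℂ = 0) (b : ℓ2) :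
    ‖⟪u, b⟫_ℂ‖ ^ 2 / ‖u‖ ^ 2 + ‖⟪w, b⟫_ℂ‖ ^ 2 / ‖w‖ ^ 2 ≤ ‖b‖ ^ 2 := by
  have hu0 : 0 < ‖u‖ := norm_pos_iff.2 hu
  have hw0 : 0 < ‖w‖ := norm_pos_iff.2 hw
  have hwu : ⟪w, u⟫_ℂ = 0 := by rw [← inner_conj_symm, huw, map_zero]
  set v : Fin 2 → ℓ2 := ![((‖u‖⁻¹ : ℝ) : ℂ) • u, ((‖w‖⁻¹ : ℝ) : ℂ) • w] with hv
  have hv0 : v 0 = ((‖u‖⁻¹ : ℝ) : ℂ) • u := rfl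
  have hv1 : v 1 = ((‖w‖⁻¹ : ℝ) : ℂ) • w := rfl
  have hn0 : ‖v 0‖ = 1 := by
    rw [hv0, norm_smul, Complex.norm_of_nonneg (inv_nonneg.2 hu0.le), inv_mul_cancel₀ hu0.ne']
  have hn1 : ‖v 1‖ = 1 := by
    rw [hv1, norm_smul, Complex.norm_of_nonneg (inv_nonneg.2 hw0.le), inv_mul_cancel₀ hw0.ne']
  have h01 : ⟪v 0, v 1⟫_ℂ = 0 := by
    rw [hv0, hv1, inner_smul_left, inner_smul_right, huw, mul_zero, mul_zero]
  have h10 : ⟪v 1, v 0⟫_ℂ = 0 := by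
    rw [hv0, hv1, inner_smul_left, inner_smul_right, hwu, mul_zero, mul_zero]
  have hon : Orthonormal ℂ v := by
    refine ⟨fun i => ?_, fun i j hij => ?_⟩
    · fin_cases i
      · exact hn0
      · exact hn1
    · fin_cases i <;> fin_cases j
      · exact absurd rfl hij
      · exact h01
      · exact h10
      · exact absurd rfl hij
  have hB := hon.sum_inner_products_le b (s := Finset.univ)
  rw [Fin.sum_univ_two] at hB
  have e0 : ‖⟪v 0, b⟫_ℂ‖ ^ 2 = ‖⟪u, b⟫_ℂ‖ ^ 2 / ‖u‖ ^ 2 := by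
    rw [hv0, inner_smul_left, Complex.conj_ofReal, norm_mul, Complex.norm_of_nonneg (inv_nonneg.2 hu0.le)]
    field_simp
  have e1 : ‖⟪v 1, b⟫_ℂ‖ ^ 2 = ‖⟪w, b⟫_ℂ‖ ^ 2 / ‖w‖ ^ 2 := by
    rw [hv1, inner_smul_left, Complex.conj_ofReal, norm_mul, Complex.norm_of_nonneg (inv_nonneg.2 hw0.le)]
    field_simp
  rw [e0, e1] at hB
  exact hB

/-- The COMPRESSION `P b = (⟨Gv₁, b⟩, 10²⁰⟨Gv₂, b⟩, 0, 0, …)`. [folklore] -/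
def Pc (b : ℓ2) : ℓ2 :=
  lp.single 2 0 ⟪Gv₁, b⟫_ℂ + lp.single 2 1 (⟪Gv₂, b⟫_ℂ / ((1 / 10 ^ 20 : ℝ) : ℂ))

/-- `(P b)₀ = ⟨Gv₁, b⟩`. [folklore] -/
lemma Pc_zero (b : ℓ2) : Pc b 0 = ⟪Gv₁, b⟫_ℂ := by
  classical
  unfold Pc
  rw [lp.coeFn_add, Pi.add_apply, lp.single_apply, lp.single_apply, Pi.single_eq_same,
    Pi.single_eq_of_ne (by norm_num : (0 : ℕ) ≠ 1), add_zero]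

/-- `(P b)₁ = 10²⁰⟨Gv₂, b⟩`. [folklore] -/
lemma Pc_one (b : ℓ2) : Pc b 1 = ⟪Gv₂, b⟫_ℂ / ((1 / 10 ^ 20 : ℝ) : ℂ) := by
  classical
  unfold Pc
  rw [lp.coeFn_add, Pi.add_apply, lp.single_apply, lp.single_apply, Pi.single_eq_same,
    Pi.single_eq_of_ne (by norm_num : (1 : ℕ) ≠ 0), zero_add]

/-- `‖P b‖² = |⟨Gv₁,b⟩|² + 10⁴⁰|⟨Gv₂,b⟩|²`. [folklore] -/
lemma norm_Pc_sq (b : ℓ2) : ‖Pc b‖ ^ 2 = ‖⟪Gv₁, b⟫_ℂ‖ ^ 2 + ‖⟪Gv₂, b⟫_ℂ‖ ^ 2 / (1 / 10 ^ 20) ^ 2 := by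
  classical
  unfold Pc
  have horth : ⟪(lp.single 2 0 ⟪Gv₁, b⟫_ℂ : ℓ2),
      (lp.single 2 1 (⟪Gv₂, b⟫_ℂ / ((1 / 10 ^ 20 : ℝ) : ℂ)) : ℓ2)⟫_ℂ = 0 := by
    rw [lp.inner_single_left, lp.single_apply, Pi.single_eq_of_ne (by norm_num : (0 : ℕ) ≠ 1),
      inner_zero_right]
  have h := norm_add_sq_eq_norm_sq_add_norm_sq_of_inner_eq_zero _ _ horth
  rw [← sq, ← sq, ← sq, lp.norm_single (by norm_num), lp.norm_single (by norm_num), norm_div,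
    Complex.norm_real, Real.norm_of_nonneg (by norm_num : (0 : ℝ) ≤ 1 / 10 ^ 20), div_pow] at h
  exact h

/-- The DILATION `Q a = (a₀/‖Gv₁‖²) Gv₁ + (10²⁰ a₁/‖Gv₁‖²) Gv₂` of a coefficient vector of the rank-one model. [folklore] -/
def Qd (a : ℓ2) : ℓ2 :=
  (a 0 / ((‖Gv₁‖ ^ 2 : ℝ) : ℂ)) • Gv₁ + (a 1 / ((1 / 10 ^ 20 * ‖Gv₁‖ ^ 2 : ℝ) : ℂ)) • Gv₂

/-- `⟨Gv₁, Q a⟩ = a₀`. [folklore] -/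
lemma inner_Gv₁_Qd (a : ℓ2) : ⟪Gv₁, Qd a⟫_ℂ = a 0 := by
  have hN : ((‖Gv₁‖ : ℝ) : ℂ) ≠ 0 := by
    have := one_le_norm_Gv₁
    exact Complex.ofReal_ne_zero.mpr (by positivity)
  unfold Qd
  rw [inner_add_right, inner_smul_right, inner_smul_right, inner_Gv₁_Gv₂, mul_zero, add_zero,
    inner_self_eq_coe_norm_sq]
  push_cast
  field_simp

/-- `⟨Gv₂, Q a⟩ = 10⁻²⁰ a₁`. [folklore] -/
lemma inner_Gv₂_Qd (a : ℓ2) : ⟪Gv₂, Qd a⟫_ℂ = ((1 / 10 ^ 20 : ℝ) : ℂ) * a 1 := by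
  have hN : ((‖Gv₁‖ : ℝ) : ℂ) ≠ 0 := by
    have := one_le_norm_Gv₁
    exact Complex.ofReal_ne_zero.mpr (by positivity)
  have h21 : ⟪Gv₂, Gv₁⟫_ℂ = 0 := by rw [← inner_conj_symm, inner_Gv₁_Gv₂, map_zero]
  unfold Qd
  rw [inner_add_right, inner_smul_right, inner_smul_right, h21, mul_zero, zero_add,
    inner_self_eq_coe_norm_sq, norm_Gv₂_sq]
  push_cast
  field_simp

/-- `‖Q a‖² = (|a₀|² + |a₁|²)/‖Gv₁‖²`. [folklore] -/
lemma norm_Qd_sq (a : ℓ2) : ‖Qd a‖ ^ 2 = (‖a 0‖ ^ 2 + ‖a 1‖ ^ 2) / ‖Gv₁‖ ^ 2 := by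
  have hN1 := one_le_norm_Gv₁
  have hN : ‖Gv₁‖ ≠ 0 := by positivity
  unfold Qd
  have horth : ⟪(a 0 / ((‖Gv₁‖ ^ 2 : ℝ) : ℂ)) • Gv₁,
      (a 1 / ((1 / 10 ^ 20 * ‖Gv₁‖ ^ 2 : ℝ) : ℂ)) • Gv₂⟫_ℂ = 0 := by
    rw [inner_smul_left, inner_smul_right, inner_Gv₁_Gv₂, mul_zero, mul_zero]
  have h := norm_add_sq_eq_norm_sq_add_norm_sq_of_inner_eq_zero _ _ horth
  rw [← sq, ← sq, ← sq, norm_smul, norm_smul, norm_div, norm_div, Complex.norm_real, Complex.norm_real,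
    Real.norm_of_nonneg (by positivity), Real.norm_of_nonneg (by positivity), mul_pow, mul_pow,
    norm_Gv₂_sq] at h
  rw [h]
  field_simp

/-- **The exact reduction.**  If `b` is the minimiser `ℓ'_ε` of (1) for `(Tst, y₀' = (√3/2)e₀, x₀ = (√3/2)e₀ + ½e₁)`,
then its compression `P b` is the minimiser of (1) for the rank-one model `(Tmodel e₀ e₁, y₀', x₀)` at the same
radius, with the same vector `V ℓ'_ε` (dilate any competitor; Bessel). [cite: Enflo2023, v2 p.2 eq. (1)–(2), pp.8–9 Lemma 1, test operator] -/
theorem isMinimal_Pc (hT : ‖Tst‖ < 1) (hTm : ‖Tmodel (e 0) (e 1)‖ < 1) {ε : ℝ} {b : ℓ2}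
    (hb : IsMinimal (V Tst hT (yStart (e 0))) (xStart (e 0) (e 1)) ε b) :
    IsMinimal (V (Tmodel (e 0) (e 1)) hTm (yStart (e 0))) (xStart (e 0) (e 1)) ε (Pc b) ∧
      V (Tmodel (e 0) (e 1)) hTm (yStart (e 0)) (Pc b) = V Tst hT (yStart (e 0)) b := by
  have hlam : ((1 / 10 ^ 20 : ℝ) : ℂ) ≠ 0 := Complex.ofReal_ne_zero.mpr (by norm_num)
  have hTy := Tmodel_yStart (e 0) (e 1) (norm_e 0)
  -- `V^{Tmodel}(P b) = V^{Tst} b`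
  have hVP : V (Tmodel (e 0) (e 1)) hTm (yStart (e 0)) (Pc b) = V Tst hT (yStart (e 0)) b := by
    rw [V_Tmodel (e 0) (e 1) (norm_e 0) inner_e0_e1 hTm (Pc b), Pc_zero, Pc_one, hTy, V_Tst hT b, yStart,
      smul_smul, smul_smul]
    congr 1
    · congr 1; ring
    · congr 1; push_cast; field_simp
  -- `V^{Tst}(Q a) = V^{Tmodel} a`
  have hVQ : ∀ a : ℓ2, V Tst hT (yStart (e 0)) (Qd a) = V (Tmodel (e 0) (e 1)) hTm (yStart (e 0)) a := by
    intro a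
    rw [V_Tmodel (e 0) (e 1) (norm_e 0) inner_e0_e1 hTm a, hTy, V_Tst hT (Qd a), inner_Gv₁_Qd, inner_Gv₂_Qd,
      yStart, smul_smul, smul_smul]
    congr 1
    · congr 1; ring
    · congr 1; push_cast; ring
  refine ⟨⟨?_, fun a ha => ?_⟩, hVP⟩
  · -- feasibility
    rw [mem_feasible, hVP]
    exact hb.norm_sub_le
  · -- minimality: dilate the competitor, compare, compress
    have hN1 := one_le_norm_Gv₁
    have hN : 0 < ‖Gv₁‖ ^ 2 := by positivity
    have hQfeas : Qd a ∈ feasible (V Tst hT (yStart (e 0))) (xStart (e 0) (e 1)) ε := by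
      rw [mem_feasible, hVQ]
      exact ha
    have h1 : ‖b‖ ≤ ‖Qd a‖ := hb.norm_le hQfeas
    have h2 : ‖b‖ ^ 2 ≤ (‖a 0‖ ^ 2 + ‖a 1‖ ^ 2) / ‖Gv₁‖ ^ 2 := by
      rw [← norm_Qd_sq]; exact pow_le_pow_left₀ (norm_nonneg _) h1 2
    have h3 : ‖a 0‖ ^ 2 + ‖a 1‖ ^ 2 ≤ ‖a‖ ^ 2 := by
      have := sum_sq_le a {0, 1}
      rwa [Finset.sum_pair (by norm_num)] at this
    have hG1 : Gv₁ ≠ 0 := by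
      intro h; rw [h, norm_zero] at hN1; linarith
    have hG2 : Gv₂ ≠ 0 := by
      intro h
      have := norm_Gv₂_sq
      rw [h, norm_zero] at this
      nlinarith
    have h4 := bessel_pair hG1 hG2 inner_Gv₁_Gv₂ b
    rw [norm_Gv₂_sq] at h4
    have h5 : ‖Pc b‖ ^ 2 / ‖Gv₁‖ ^ 2 ≤ ‖b‖ ^ 2 := by
      rw [norm_Pc_sq]
      have : ‖⟪Gv₁, b⟫_ℂ‖ ^ 2 / ‖Gv₁‖ ^ 2 + ‖⟪Gv₂, b⟫_ℂ‖ ^ 2 / ((1 / 10 ^ 20) ^ 2 * ‖Gv₁‖ ^ 2) =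
          (‖⟪Gv₁, b⟫_ℂ‖ ^ 2 + ‖⟪Gv₂, b⟫_ℂ‖ ^ 2 / (1 / 10 ^ 20) ^ 2) / ‖Gv₁‖ ^ 2 := by
        field_simp
      rw [← this]; exact h4
    have h6 : ‖Pc b‖ ^ 2 ≤ ‖a‖ ^ 2 := by
      have := (div_le_iff₀ hN).1 (h5.trans (h2.trans ((div_le_div_iff_of_pos_right hN).2 h3)))
      rwa [div_mul_cancel₀ _ hN.ne'] at this
    exact (pow_le_pow_iff_left₀ (norm_nonneg _) (norm_nonneg _) two_ne_zero).1 h6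

/-- **`εθ(ℓ'_ε) ≥ 0.86·10⁻²⁰` for `Tst`** at every radius `ε ∈ [½ − w, ½]`, `0 < w ≤ 2·10⁻⁴` — transferred verbatim
from the rank-one model (`Lemma1.model_etheta_lower_all`) through `isMinimal_Pc`. [cite: Enflo2023, v2 p.3 eq. (5)–(6), pp.8–9 Lemma 1, test operator] -/
theorem etheta_lower_standing (hT : ‖Tst‖ < 1) {w ε : ℝ} (hw0 : 0 < w) (hw1 : w ≤ 2 / 10 ^ 4)
    (hε1 : 1 / 2 - w ≤ ε) (hε2 : ε ≤ 1 / 2) (b : ℓ2)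
    (hb : IsMinimal (V Tst hT (yStart (e 0))) (xStart (e 0) (e 1)) ε b) :
    0.86 / 10 ^ 20 ≤ (⟪xStart (e 0) (e 1) - V Tst hT (yStart (e 0)) b, V Tst hT (yStart (e 0)) b⟫_ℂ).re := by
  have hTm := norm_Tmodel_lt_one (e 0) (e 1) (norm_e 0) (norm_e 1)
  obtain ⟨hmin, hV⟩ := isMinimal_Pc hT hTm hb
  have h := model_etheta_lower_all (e 0) (e 1) (norm_e 0) (norm_e 1) inner_e0_e1 hTm hw0 hw1 hε1 hε2 (Pc b) hmin
  rwa [hV] at h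

/-- **The printed Lemma 1 fails for `(Tst, e₀, e₁)` for every `10⁻²⁰ < (εθ)₀ < 1.72·10⁻¹⁵`**: the printed
requirement `‖T*u₁‖ < (εθ)₀` holds and the printed conclusion fails at every radius of the printed window.
[cite: Enflo2023, v2 p.7 (choice of u₁), pp.8–9 Lemma 1] -/
theorem printed_lemma1_fails_standing_all (hT : ‖Tst‖ < 1) {e₀ : ℝ} (he0 : 1 / 10 ^ 20 < e₀)
    (he1 : e₀ < 1.72 / 10 ^ 15) :
    ‖adjoint Tst (e 1)‖ < e₀ ∧
    ¬ ∃ (ε : ℝ) (a : ℓ2), 1 / 2 - e₀ / 10 ^ 5 < ε ∧ ε ≤ 1 / 2 ∧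
        IsMinimal (V Tst hT (yStart (e 0))) (xStart (e 0) (e 1)) ε a ∧
        (⟪xStart (e 0) (e 1) - V Tst hT (yStart (e 0)) a, V Tst hT (yStart (e 0)) a⟫_ℂ).re
          ≤ e₀ / (2 * 10 ^ 5) := by
  refine ⟨by rw [norm_adjoint_Tst_e1]; exact he0, ?_⟩
  rintro ⟨ε, a, h1, h2, ha, hθ⟩
  have hw0 : 0 < e₀ / 10 ^ 5 := by
    have : (0 : ℝ) < e₀ := lt_trans (by norm_num) he0
    positivity
  have hw1 : e₀ / 10 ^ 5 ≤ 2 / 10 ^ 4 := by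
    rw [div_le_div_iff₀ (by positivity) (by positivity)]; nlinarith
  have h := etheta_lower_standing hT hw0 hw1 h1.le h2 a ha
  have : e₀ / (2 * 10 ^ 5) < 0.86 / 10 ^ 20 := by
    rw [div_lt_div_iff₀ (by positivity) (by positivity)]; nlinarith
  linarith

/-- **Standing-form, Type-1 counter-model to the printed Lemma 1 (packaged).**  On `ℓ²(ℕ)` (infinite-dimensional,
separable) there are an operator `T` and orthonormal `u₀, u₁` with: `‖T‖ = 10⁻²⁰`, `T` injective, with dense
non-closed range, self-adjoint, of Type 1 via `u₀` ((19), v2 p.6); `‖T*u₁‖ = 10⁻²⁰`; and for EVERY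
`(εθ)₀ ∈ (10⁻²⁰, 1.72·10⁻¹⁵)` the printed choice `‖T*u₁‖ < (εθ)₀` holds while the printed conclusion of Lemma 1
fails at every radius `ε ∈ (½ − 10⁻⁵(εθ)₀, ½]`.  (Not modelled: cyclicity of `u₀`.) [cite: Enflo2023, v2 p.1, p.6 (19), p.7 (choice of u₁), pp.8–9 Lemma 1] -/
theorem printed_lemma1_fails_standing :
    ∃ (T : ℓ2 →L[ℂ] ℓ2) (hT : ‖T‖ < 1) (u₀ u₁ : ℓ2),
      ‖T‖ = 1 / 10 ^ 20 ∧ Function.Injective T ∧ DenseRange T ∧ ¬ Function.Surjective T ∧ IsSelfAdjoint T ∧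
      ‖u₀‖ = 1 ∧ ‖u₁‖ = 1 ∧ ⟪u₀, u₁⟫_ℂ = 0 ∧
      (∀ n : ℕ, 1 ≤ n → ∃ δ : ℝ, 0 < δ ∧ ∀ y : ℓ2, Referee.AngleCond u₀ y →
          ∃ j : ℕ, n ≤ j ∧ δ * ‖y‖ ^ 2 ≤ ‖⟪(⇑T)^[j] y, y⟫_ℂ‖) ∧
      ‖adjoint T u₁‖ = 1 / 10 ^ 20 ∧
      ∀ e₀ : ℝ, 1 / 10 ^ 20 < e₀ → e₀ < 1.72 / 10 ^ 15 →
        ‖adjoint T u₁‖ < e₀ ∧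
        ¬ ∃ (ε : ℝ) (a : ℓ2), 1 / 2 - e₀ / 10 ^ 5 < ε ∧ ε ≤ 1 / 2 ∧
            IsMinimal (V T hT (yStart u₀)) (xStart u₀ u₁) ε a ∧
            (⟪xStart u₀ u₁ - V T hT (yStart u₀) a, V T hT (yStart u₀) a⟫_ℂ).re ≤ e₀ / (2 * 10 ^ 5) :=
  ⟨Tst, norm_Tst_lt_one, e 0, e 1, norm_Tst, Tst_injective, Tst_denseRange,
    Tst_not_surjective, Tst_isSelfAdjoint, norm_e 0, norm_e 1, inner_e0_e1, Tst_type1_via_e0,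
    norm_adjoint_Tst_e1, fun _ he0 he1 => printed_lemma1_fails_standing_all norm_Tst_lt_one he0 he1⟩

end Standing

end Lemma1

end Literature.Analysis.OperatorTheory.Enflo2023
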